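import Summits.BirchSwinnertonDyer.BirchSwinnertonDyer.Theses.ThetaPartnerAtTwo
import Summits.BirchSwinnertonDyer.BirchSwinnertonDyer.Theorems.ThetaPartnerAtTwoSignedTransportAtTwoRlfLambdaOfPrint
import Summits.BirchSwinnertonDyer.BirchSwinnertonDyer.Theorems.ThetaPartnerAtTwoSignedTransportAtTwoBridgeOrientedResidual
import Summits.BirchSwinnertonDyer.BirchSwinnertonDyer.Theorems.ThetaPartnerAtTwoSignedTransportAtTwoBridgeNonPrimitive
import Summits.BirchSwinnertonDyer.BirchSwinnertonDyer.Theorems.ThetaPartnerAtTwoSignedTransportAtTwoSelmerPontryagin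
import Summits.BirchSwinnertonDyer.BirchSwinnertonDyer.Theorems.ThetaPartnerAtTwoSignedTransportAtTwoSplitGlue
import Summits.BirchSwinnertonDyer.BirchSwinnertonDyer.Theorems.ThetaPartnerAtTwoResidualLocalTransportAtTwo
import Summits.BirchSwinnertonDyer.BirchSwinnertonDyer.Theorems.ThetaPartnerAtTwoSignedMainConjectureCMTwoRankZeroOfLocal
import Literature.NumberTheory.EllipticCurves.Kobayashi2003.SignedSelmerModuleFiniteProofs
import HarnessLib

/-!
# Crux `SignedTransportAtTwo` (stmt-BirchSwinnertonDyer-20333, route `ThetaPartnerAtTwo`) AT ANALYTIC RANK ZERO OF THE PARTNER,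
# FROM PRINT: `PUB⁴ → GZK → MazurTateCongruenceAtTwoR → K1Ar`, where K1Ar is the crux text with ONE extra binder
# `A.analyticRank = 0` (lead prover bsd-wall-tp2-p1 g8, line `bridge`; `--supports`; closes nothing — certificate for a restatement)

HONEST FRAMING. THEOREMS ONLY; every research input is an explicit hypothesis BY NAME; BSD is not proved by any of this.

THE POINT. The crux `SignedTransportAtTwo` quantifies over CM partners `A` of ANY analytic rank, but the route's `closes` only ever
instantiates it at a partner with `A.analyticRank = 0` (the habitat clause `hAr`, needed there anyway to produce the Pollack pair of `f_A`).
With that one binder added, the TWO algebraic research stubs of line `bridge` (skeleton v24: `stub_surj2` = GV Prop. (2.1) at `2`,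
`stub_plusDiv2` = B. D. Kim 2013 at `2`) are theorems modulo the four PRINTED-but-unproved facts of Greenberg LNM 1716 and
Gross–Zagier–Kolyvagin (`Sel_{2^∞}(E/ℚ)` finite at analytic rank `0`), for BOTH curves of the pair: the K4 seats' `SignedEC` files
(`sharp_localRes_surjective_two_of_print4`, `signedSelmerInfty_two_divisible_of_print4`) + this seat's dictionary and re-run
(`exists_localCurrency_hom`, `surj2_of_print4`, `rlf2_of_print4`, `lam2d_of_print4`). What is left of K1 at rank `0` is EXACTLY the
analytic child `MazurTateCongruenceAtTwoR` (stmt-21416, Vatsal 1999 / EPW 2006 at `p = 2`, research) — taken here as a hypothesis BY NAME.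

* `signedTransportAtTwo_rankZero_of_print4` : `casselsSurjectivity_H1Sigma ℚ → prop412_noFiniteSubmodule_H1Sigma_of_rank_one →
  h1Sigma_zpCorank_le_degree ℚ → h1SigmaInfty_rank_eq_one → rank_eq_analyticRank_of_analyticRank_le_one → MazurTateCongruenceAtTwoR →`
  (the text of `SignedTransportAtTwo` with `A.analyticRank = 0 →` inserted after `A.HasCM →`, VERBATIM otherwise).

Proof = the skeleton's composition `signedTransportAtTwo_of_gvBinders_nonPrimitive` (p. BridgeNonPrimitive) made POINTWISE in the pair:
μ/torsion transfer `muTorsion2_of_fin2 (fin2_of_sel2 (SplitGlue.sel2_of_UTL residualLocalTransportAtTwo_proof))` (all landed, all ranks),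
analytic binder `v2np_of_v2congR (v2congR_of_v2mtR hMT)`, and the λ-identity from `lam2d_of_print4` at the two finite Selmer groups.

FOR THE PEN (restatement, mirrors K2r0P `SignedMainConjectureCMTwoRankZeroOfPub`): K1P := PUB⁴ (conjuncts 1,2,3,5 of
`PublishedInputsGreenbergControlAtTwo`) → `RankEqAnalyticRankLeOne`-fact → `MazurTateCongruenceAtTwoR` → K1Ar; `closes` then reads
`hT hG1 hG2 hG3 hG5 hGZK hMT W A hcm hr hss ha hAcm hAr hAss hAa hcong …` (it already holds `hAr`). This file is that K1P's proof.

References: [GreenbergVatsal2000] §1 pp. 8–9, Thm. (1.4), §2 Props. (2.1), (2.4), (2.5), (2.8), (10); [BDKim2009] Cor. 2.13;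
[BDKim2013] Thm. 1.1; [GreenbergLNM1716] §4 Props. 4.12–4.15, p. 108; [Kolyvagin1990] Thm. A; [GrossZagier1986] Thm. I.6.3;
[Vatsal1999] Thm. (1.10); [EmertonPollackWeston2006] Thm. 1; [Kobayashi2003] Thm. 1.2, Conjecture (p. 2).
-/

set_option autoImplicit false
-- D-0017: single-problem summit, so `Summit.BirchSwinnertonDyer.BirchSwinnertonDyer.…` repeats a namespace BY DESIGN.
set_option linter.dupNamespace false

noncomputable section

open scoped Classical MatrixGroups ModularForm BigOperators

open CongruenceSubgroup WeierstrassCurve NumberField IsDedekindDomain Rat.HeightOneSpectrum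
  Literature Literature.NumberTheory.EllipticCurves
  Literature.NumberTheory.EllipticCurves.ModularForms
  Literature.NumberTheory.EllipticCurves.Rank1Residual
  Literature.NumberTheory.EllipticCurves.Kobayashi2003 ZpExtension
  Literature.NumberTheory.EllipticCurves.GreenbergVatsal2000
  Summit.BirchSwinnertonDyer.Rank1Residual.X1.MuLambda
  Summit.BirchSwinnertonDyer.Rank1Residual.Supersingular
  Summit.BirchSwinnertonDyer.Rank1Residual.X2.EulerFactorInvariants
  Summit.BirchSwinnertonDyer.BirchSwinnertonDyer.Theorems.TwoAdicTwistConverse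

namespace Summit.BirchSwinnertonDyer.BirchSwinnertonDyer.Theorems.SignedTransportAtTwo

/-- **K1 at analytic rank `0` of the partner, from print.** Granted the four printed Greenberg facts (Cassels surjectivity, Prop. 4.12,
the corank bound, weak Leopoldt — Literature named facts, unproved in the tree), Gross–Zagier–Kolyvagin (named fact) and the analytic
child `MazurTateCongruenceAtTwoR` (stmt-21416, research): the statement of the crux `SignedTransportAtTwo` with the single extra binder
`A.analyticRank = 0` (inserted after `A.HasCM`). Everything algebraic in line `bridge` is thereby closed modulo print at rank `0`.
[cite: GreenbergVatsal2000, Thm. (1.4), Props. (2.1), (2.4), (2.5), (2.8)] [cite: BDKim2009, Cor. 2.13] [cite: BDKim2013, Thm. 1.1]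
[cite: GreenbergLNM1716, §4 Props. 4.12–4.15 and p. 108] [cite: Vatsal1999, Thm. (1.10)] [cite: Kobayashi2003, Conjecture (p. 2)] -/
theorem signedTransportAtTwo_rankZero_of_print4 (hC : Greenberg1999.casselsSurjectivity_H1Sigma ℚ)
    (h412 : Greenberg1999.prop412_noFiniteSubmodule_H1Sigma_of_rank_one)
    (hcork : Greenberg1999.h1Sigma_zpCorank_le_degree ℚ) (hWL : Greenberg1999.h1SigmaInfty_rank_eq_one)
    (hGZK : rank_eq_analyticRank_of_analyticRank_le_one)
    (hMT : Summit.BirchSwinnertonDyer.BirchSwinnertonDyer.Theses.ThetaPartnerAtTwo.MazurTateCongruenceAtTwoR) :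
    ∀ (W : WeierstrassCurve ℚ) [W.IsElliptic] [W.IsGloballyMinimal] (A : WeierstrassCurve ℚ) [A.IsElliptic] [A.IsGloballyMinimal], ¬ W.HasCM → W.analyticRank = 0 → Literature.NumberTheory.EllipticCurves.Rank1Residual.GoodSS W 2 → W.frobeniusTrace 2 = 0 → A.HasCM → A.analyticRank = 0 → Literature.NumberTheory.EllipticCurves.Rank1Residual.GoodSS A 2 → A.frobeniusTrace 2 = 0 → (∃ e : WeierstrassCurve.geomTorsion W (2 : ℤ) ≃+ WeierstrassCurve.geomTorsion A (2 : ℤ), ∀ (σ : Field.absoluteGaloisGroup ℚ) (P : WeierstrassCurve.geomTorsion W (2 : ℤ)), e (σ • P) = σ • e P) → ∀ [NeZero (A.conductorNorm ℤ)] (fA : CuspForm (CongruenceSubgroup.Gamma0 (A.conductorNorm ℤ)) 2), Literature.NumberTheory.EllipticCurves.ModularForms.IsNewformOf A fA → ∀ (ϖA : ℚ), (ϖA : ℝ) * A.realPeriodRat = Literature.NumberTheory.EllipticCurves.ModularForms.plusPeriod fA → ∀ (LsharpA LflatA : Literature.NumberTheory.EllipticCurves.IwasawaAlgebra 2), Summit.BirchSwinnertonDyer.Rank1Residual.Supersingular.IsPollackPair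 fA 2 LsharpA LflatA → (∀ (κ : Literature.NumberTheory.EllipticCurves.ZpExtension ℚ 2) (γ : Field.absoluteGaloisGroup ℚ), κ.IsCyclotomic → κ.IsTopGenerator γ → ∀ D : Literature.NumberTheory.EllipticCurves.Kobayashi2003.SignedSelmerDualData A κ γ 1, Module.IsTorsion (Literature.NumberTheory.EllipticCurves.IwasawaAlgebra 2) D.X ∧ D.mu = 0) → Summit.BirchSwinnertonDyer.Rank1Residual.Supersingular.KobayashiMainConjecture A 2 1 → (∀ (κ : Literature.NumberTheory.EllipticCurves.ZpExtension ℚ 2) (γ : Field.absoluteGaloisGroup ℚ), κ.IsCyclotomic → κ.IsTopGenerator γ → Literature.NumberTheory.EllipticCurves.IsCyclotomicVariable 2 γ → ∀ [NeZero (W.conductorNorm ℤ)] (f : CuspForm (CongruenceSubgroup.Gamma0 (W.conductorNorm ℤ)) 2), Literature.NumberTheory.EllipticCurves.ModularForms.IsNewformOf W f → ∀ (ϖ : ℚ), (ϖ : ℝ) * W.realPeriodRat = Literature.NumberTheory.EllipticCurves.ModularForms.plusPeriod f → ∀ (Lplus Lminus : Literature.NumberTheory.EllipticCurves.IwasawaAlgebra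 2), Summit.BirchSwinnertonDyer.Rank1Residual.Supersingular.IsPollackPair f 2 Lplus Lminus → ∀ (D : Literature.NumberTheory.EllipticCurves.Kobayashi2003.SignedSelmerDualData W κ γ 1), ∃ (g h : Literature.NumberTheory.EllipticCurves.IwasawaAlgebra 2) (m : ℕ), D.charIdeal = Ideal.span {g} ∧ Literature.NumberTheory.EllipticCurves.iwasawaToPowerSeries 2 (g * h) = PowerSeries.C ((2 : ℚ_[2]) ^ m * (ϖ : ℚ_[2])) * Literature.NumberTheory.EllipticCurves.iwasawaToPowerSeries 2 (Summit.BirchSwinnertonDyer.Rank1Residual.Supersingular.kobayashiL 1 Lplus Lminus)) → Summit.BirchSwinnertonDyer.Rank1Residual.Supersingular.KobayashiMainConjecture W 2 1 := by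
  -- the all-rank transfers, landed: μ/torsion (sel2 ⇒ fin2 ⇒ Kμ2′) and the analytic binder V2np from R-A
  have hmuT := muTorsion2_of_fin2 (fin2_of_sel2 (SplitGlue.sel2_of_UTL residualLocalTransportAtTwo_proof))
  have hV2 := v2np_of_v2congR (v2congR_of_v2mtR hMT)
  intro W _ _ A _ _ hcm hr hss ha hAcm hAr hAss hAa hiso _ fA hfA ϖA hϖA LplusA LminusA hPPA hAside hMCA hKato
    κ γ hκ hγ hcv _ f hf ϖ hϖ Lplus Lminus hPP D
  -- the partner's datum at the same `(κ, γ)`, its structure (K2 binder) and finite generation (tree theorem)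
  obtain ⟨DA⟩ := nonempty_signedSelmerDualData A κ (1 : ℤˣ) hγ
  obtain ⟨hXA, hμA⟩ := hAside κ γ hκ hγ DA
  haveI : Module.Finite (IwasawaAlgebra 2) D.X := D.moduleFinite hγ
  haveI : Module.Finite (IwasawaAlgebra 2) DA.X := DA.moduleFinite hγ
  -- Kμ2′: torsion AND `μ = 0` of `X⁺_W`, transported from the partner
  obtain ⟨hX, hμD⟩ := hmuT W A hcm hr hss ha hAcm hAss hAa hiso κ γ hκ hγ D DA hXA hμA
  refine ⟨hX, ?_⟩
  -- Kato's divisibility for W (K3 shape, crux binder)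
  obtain ⟨g, h, m, hchar, hgh⟩ := hKato κ γ hκ hγ hcv f hf ϖ hϖ Lplus Lminus hPP D
  set ι := iwasawaToPowerSeries 2 with hι
  set L := kobayashiL (1 : ℤˣ) Lplus Lminus with hLdef
  have hL0 : PowerSeries.C (ϖ : ℚ_[2]) * ι L ≠ 0 := C_mul_iota_ne_zero hf hϖ hPP
  have hgh0 : g * h ≠ 0 := by
    intro h0
    apply C_pow_mul_ne_zero m hL0
    rw [← hgh, h0, map_zero]
  have hg0 : g ≠ 0 := left_ne_zero_of_mul hgh0
  have hh0 : h ≠ 0 := right_ne_zero_of_mul hgh0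
  -- the partner's main conjecture at the supplied analytic frame
  obtain ⟨-, gA, hcharA, hιA⟩ := hMCA κ γ hκ hγ hcv fA hfA ϖA hϖA LplusA LminusA hPPA DA
  have hgA0 : gA ≠ 0 := by
    intro h0
    apply C_mul_iota_ne_zero hfA hϖA hPPA
    rw [← hιA, h0, map_zero]
  -- an admissible S₀ (PROVED in the landed bridge) and the PROVED local sums at 2
  obtain ⟨S₀, hS₀2, hS₀W, hS₀A⟩ := exists_admissiblePlaces W A hss.1 hAss.1
  obtain ⟨-, hμPW, hlamPW⟩ := mu_lam_mul_eulerFactorProduct_two W S₀ hS₀2 hgh0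
  obtain ⟨-, hμPA, hlamPA⟩ := mu_lam_mul_eulerFactorProduct_two A S₀ hS₀2 hgA0
  -- Kλ2 at 2: λ(X⁺_W) + Σ_W = λ(X⁺_A) + Σ_A
  -- Kλ2 at 2 FROM PRINT: both curves have analytic rank 0, so `Sel_{2^∞}` finite (GZK), and `lam2d_of_print4` applies
  have hSelW : Finite (W.selmerGroupPInfty 2) := finite_selmerGroupPInfty_two_of_analyticRank_eq_zero W hGZK hr
  have hSelA : Finite (A.selmerGroupPInfty 2) := finite_selmerGroupPInfty_two_of_analyticRank_eq_zero A hGZK hAr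
  have hlamD := lam2d_of_print4 hC h412 hcork hWL W A hcm hr hss ha hAcm hAss hAa hiso hSelW hSelA κ γ hκ hγ S₀ hS₀2
    hS₀W hS₀A D DA hX hXA hμD hμA
  -- generator lemmas: element-level μ/λ of g, g_A are the module invariants
  have hμg : mu g = 0 := by
    rw [Summit.BirchSwinnertonDyer.Rank1Residual.X1.MuPart.mu_generator_eq_muInvariant D.X hX hg0 hchar]
    exact hμD
  have hμgA : mu gA = 0 := by
    rw [Summit.BirchSwinnertonDyer.Rank1Residual.X1.MuPart.mu_generator_eq_muInvariant DA.X hXA hgA0 hcharA]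
    exact hμA
  have hlamg : lam g = lambdaInvariant 2 D.X :=
    Summit.BirchSwinnertonDyer.Rank1Residual.X1.ParitySqueeze.lam_generator_eq_lambdaInvariant D.X hX hg0 hchar
  have hlamgA : lam gA = lambdaInvariant 2 DA.X :=
    Summit.BirchSwinnertonDyer.Rank1Residual.X1.ParitySqueeze.lam_generator_eq_lambdaInvariant DA.X hXA hgA0
      hcharA
  -- V2np at (G, m) := (g·h, m) and (G_A, m') := (g_A, 0), where μ(g_A · ∏𝒫(A)) = μ(g_A) = 0
  have hιA' : ι gA = PowerSeries.C ((2 : ℚ_[2]) ^ 0 * (ϖA : ℚ_[2])) * ι (kobayashiL 1 LplusA LminusA) := by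
    rw [pow_zero, one_mul]; exact hιA
  have hμPA0 : mu (gA * eulerFactorProduct A 2 S₀) = 0 := by rw [hμPA, hμgA]
  obtain ⟨hμan, hlaman⟩ := hV2 W A hcm hr hss ha hAcm hAss hAa hiso γ hcv f hf ϖ hϖ
    Lplus Lminus hPP fA hfA ϖA hϖA LplusA LminusA hPPA S₀ hS₀2 hS₀W hS₀A (g * h) m hgh gA 0 hιA' hμPA0
  -- bookkeeping: μ(h) = m, λ(h) = 0
  rw [hμPW, mu_mul hg0 hh0, hμg] at hμan
  rw [hlamPW, hlamPA, lam_mul hg0 hh0, hlamg, hlamgA] at hlaman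
  have hμh : mu h = m := by omega
  have hlamh : lam h = 0 := by omega
  -- h = 2^m · unit, and (g·u) is the Néron-normalised generator
  obtain ⟨u, hu⟩ := exists_unit_of_mu_of_lam hh0 hμh hlamh
  have h2m : (PowerSeries.C ((2 : ℚ_[2]) ^ m) : PowerSeries ℚ_[2]) ≠ 0 :=
    (map_ne_zero_iff _ PowerSeries.C_injective).mpr (pow_ne_zero m two_ne_zero)
  have hιh : ι h = PowerSeries.C ((2 : ℚ_[2]) ^ m) * ι (u : IwasawaAlgebra 2) := by
    rw [hu, map_mul, hι, PowerSeries.map_C, map_pow, map_ofNat]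
  refine ⟨g * u, ?_, ?_⟩
  · rw [hchar]; exact (Ideal.span_singleton_mul_right_unit u.isUnit g).symm
  · have key : PowerSeries.C ((2 : ℚ_[2]) ^ m) * ι (g * u) =
        PowerSeries.C ((2 : ℚ_[2]) ^ m) * (PowerSeries.C (ϖ : ℚ_[2]) * ι L) := by
      calc PowerSeries.C ((2 : ℚ_[2]) ^ m) * ι (g * ↑u)
          = ι g * (PowerSeries.C ((2 : ℚ_[2]) ^ m) * ι ↑u) := by rw [map_mul]; ring
        _ = ι (g * h) := by rw [map_mul, hιh]
        _ = PowerSeries.C ((2 : ℚ_[2]) ^ m * (ϖ : ℚ_[2])) * ι L := hgh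
        _ = PowerSeries.C ((2 : ℚ_[2]) ^ m) * (PowerSeries.C (ϖ : ℚ_[2]) * ι L) := by
          rw [map_mul, mul_assoc]
    exact mul_left_cancel₀ h2m key

end Summit.BirchSwinnertonDyer.BirchSwinnertonDyer.Theorems.SignedTransportAtTwo

end
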